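import Summits.HubbardSuperconductivity.HubbardSuperconductivity.Theses.AposterioriCapRg
import Literature.MathematicalPhysics.QuantumLattice.SymmetricRegimeFunctionalsD4

/-!
# Stub `stub_cooperC4v` of line `strict-continuum-certificate-transfer`
# (crux `CapRgSymmetricCertificatePinned`, item stmt-HubbardSuperconductivity-14045, route AposterioriCapRg)

`D₄` covariance of the Cooper matrix of the countertermed effective action of the `2D` Hubbard torus
at seed `h = 0`: for every `γ` in the point group `D₄ ≅ C₄ᵥ` of the square lattice (acting on the torus
momenta by the tree's `d4Site`),

  `A(γk⃗, γk⃗') = A(k⃗, k⃗')`,  `A = cooperMatrix L M β e_K Λ 𝒢^K_Λ`,  `𝒢^K_Λ = hubbardEffectiveActionCT L M β U μ 0 K Λ`.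

The proof is the Literature theorem `cooperMatrix_hubbardEffectiveActionCT_d4Site`
(`SymmetricRegimeFunctionalsD4.lean`), assembled from: relabelling equivariance of Salmhofer's
`Δ_C` calculus, of `effAction` and of the kernels (`GrassmannRelabelling.lean`); `D₄` invariance of the
renormalised band `e_K`, of the seedless CT covariance above scale `Λ` and of the interaction slot
`V + 𝒩_K`, hence of `𝒢^K_Λ` and of all its kernels (`HubbardEffectiveActionCTSymmetry.lean`); and the
covariance of the certificate functionals of a `D₄`-invariant `G` (`SymmetricRegimeFunctionalsD4.lean`).
This is the covariance hypothesis of the neighbour stub `stub_dominanceOfMargins` in the composition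
`CapRgSymmetricCertificatePinned_of`.
-/

namespace Summit.HubbardSuperconductivity.CapRgSymmetricCertificatePinned.StrictContinuum

open Literature.MathematicalPhysics.QuantumLattice Literature.Probability.LatticeModels Matrix

/-- **Stub `stub_cooperC4v`** (`D₄` covariance of the Cooper matrix of the countertermed effective
action): the point group of the square lattice acts on the torus momenta by `d4Site`; the CT covariance,
the cutoff and the Hubbard vertex are invariant, hence so is the effective action and every kernel
functional built from it covariantly — in particular the Cooper matrix:
`A(γk⃗, γk⃗') = A(k⃗, k⃗')` for `A = cooperMatrix L M β (nambuXiCT L μ K) Λ (hubbardEffectiveActionCT L M β U μ 0 K Λ)`. -/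
theorem stub_cooperC4v : ∀ (L M : ℕ) [NeZero L] [NeZero M] (β U μ Λ : ℝ) (K : TrigPolyC4v)
    (γ : DihedralGroup 4) (k k' : TorusSite 2 L),
    cooperMatrix L M β (nambuXiCT L μ K) Λ (hubbardEffectiveActionCT L M β U μ 0 K Λ) (d4Site γ k) (d4Site γ k') =
      cooperMatrix L M β (nambuXiCT L μ K) Λ (hubbardEffectiveActionCT L M β U μ 0 K Λ) k k' :=
  fun L M _ _ β U μ Λ K γ k k' => cooperMatrix_hubbardEffectiveActionCT_d4Site L M β U μ Λ K γ k k'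

end Summit.HubbardSuperconductivity.CapRgSymmetricCertificatePinned.StrictContinuum
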